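import Mathlib
import Literature.NumberTheory.LFunctions.Zhang2022.SkeletonPartThree
import HarnessLib

/-!
# Zhang (2022), §6 typed statement-exact: the proof of the approximate formula for `L(s,ψ)`
# (Lemma 6.1) — displays (6.1)–(6.5) and every proof-internal claim, as named `Prop`s

Topic `Literature/NumberTheory/LFunctions/Zhang2022` (Landau–Siegel audit tree; verdict-neutral).
Y. Zhang, *Discrete mean estimates and the Landau–Siegel zero*, arXiv:2211.02515v1 (2022)
[Zhang2022LandauSiegel] — **an unrefereed manuscript under adjudication. Every `def … : Prop` below
is a CLAIM OF THE MANUSCRIPT, STATED NOT ASSERTED; nothing here asserts or denies its Theorems 1–2.**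
Campaign D-0069 (statements-first), slice L2-t1 = §6 whole (PDF pp. 30–32, tex L1674–1781 of the
arXiv source `lsz3__2_.tex`): ONE DECLARATION PER ITEM, constants verbatim, over the banked
skeleton's objects (`Skeleton.gstar`, `Skeleton.Kchar`, `Skeleton.Nchar`, `Skeleton.psiFn`,
`Skeleton.psiBarFn`, `Skeleton.E1main`, `Skeleton.P4`, `Skeleton.bigT`, …), which are CITED, not
restated. Statement-only; typed ≠ discharged. DAG node ids (`plan/DAG.tsv`) are the first token of
each docstring.

| decl | DAG node | locator | printed item |
|---|---|---|---|
| (banked objects `Skeleton.gstar`, `Skeleton.P4`, `Skeleton.bigT`) | `§6.u001`, `§6.u002` | p. 30, L1680, L1688 | `g*(y)`; `P₄ = PT⁻²t₀`, `T = exp{𝓛^{1.1}}` |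
| `Lemma61A` (+ banked `Skeleton.Lemma61`, objects `Kchar`, `Nchar`, `E1main`) | `Lem6.1`, `§6.u003`–`u006` | pp. 30–31, L1692–1704 | Lemma 6.1 — banked; `Lemma61A` = its print-faithful form WITH the blanket Assumption (A) (see below) |
| `Step6u007` | `§6.u007` | p. 31, L1707 | "By (4.3) … `(1/2πi)∫_{(1)} L(s+w,ψ)P₄^w ω₁(w)dw/w = K(s,ψ) + O(ε)`" |
| `Step6u008` | `§6.u008` | p. 31, L1711 | "moving the line of integration to `u = −1`": `… = L(s,ψ) + (1/2πi)∫_{(−1)} …` |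
| `Eq61` | `(6.1)` | p. 31, L1715 | `(1/2πi)∫_{(−1)} L(s+w,ψ)P₄^w ω₁(w)dw/w = −Z(s,ψ)N(1−s,ψ̄) + O(E₁(s,ψ))` |
| `Step6u009` | `§6.u009` | p. 31, L1724 | "For `u = −1` … by (2.2)": `L(s+w,ψ) = Z(s+w,ψ)(Σ_{n<T³} + Σ_{n≥T³}) ψ̄(n)n^{−(1−s−w)}` |
| `Eq62` | `(6.2)` | p. 31, L1729 | `∫_{(−1)} Z(s+w,ψ)(Σ_{n≥T³} …)P₄^w ω₁(w)dw/w ≪ ε` |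
| `Step6u010` | `§6.u010`–`u012` | pp. 31–32, L1735–1745 | the contour move to `u = −𝓛⁹, |v| ≤ 𝓛²⁰` with horizontal segments `|v| = 𝓛²⁰` |
| `Step6outer` | `Lem6.1.pf` prose | p. 32, L1746 | "the integrals on the segments `u = −1`, `|v| > 𝓛²⁰` contribute `≪ ε`" |
| `Step6u013` | `§6.u013` | p. 32, L1747 | `Z(s+w,ψ)P₄^w ≪ (2T²)^{−u}` for `−𝓛⁹ ≤ u ≤ −1`, `|v| ≤ 𝓛²⁰` ("by (4.)" — dangling reference in the source) |
| `Step6u014` | `§6.u014` | p. 32, L1751 | `Σ_{n≥T³} ψ̄(n)n^{−(1−s−w)} ≪ T^{3u+1/2}` |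
| `DedEq62` | `Lem6.1.pf` prose | p. 32, L1754 | "whence (6.2) follows" |
| `Eq63` | `(6.3)` | p. 32, L1755 | `(1/2πi)∫_{−1−i𝓛²⁰}^{−1+i𝓛²⁰} Z(s+w,ψ)(Σ_{n<T³}…)P₄^w ω₁(w)dw/w = −Z(s,ψ)N(1−s,ψ̄) + O(E₁)` |
| `DedEq61` | `Lem6.1.pf` prose | p. 32, L1754 | "The proof of (6.1) is therefore reduced to showing (6.3)" |
| `bigP_mul_t0_div_P4` | `Lem6.1.pf` prose | p. 32, L1762 | "Note that `Pt₀/P₄ = T²`" — PROVED |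
| `Iprime`, `Idprime` | `(6.4)`, `(6.5)` | p. 32, L1765, L1769 | the integrals `I′`, `I″` (objects, AS PRINTED) |
| `Step6split` | `Lem6.1.pf` prose | p. 32, L1762 | "The left side of (6.3) is equal to `I′ + I″`" |
| `Step6u015` | `§6.u015` | p. 32, L1774 | `I′ = −Z(s,ψ)N(1−s,ψ̄) + O(ε)` |
| `Step6last` | `Lem6.1.pf` prose | p. 32, L1777 | "moving the segment … to `u = 0` … applying Lemma 5.1 … the right side of (6.5) is `≪ E₁(s,ψ)`" |
| `eq63_of_steps`, `lemma61A_of_steps`, `dedLem61` | EDGES | p. 31 L1714; p. 32 L1762–1778 | the purely additive deductions and the whole §6 proof node, kernel-checked |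

**Assumption (A).** §5 p. 28 (tex L1559): "Throughout the rest of this paper we assume that (A)
holds. This assumption will not be repeated in the statements of the lemmas and propositions in
the sequel." §6 postdates it, so every claim here carries `Skeleton.AssumptionA D χ →` inside
`ForAllLarge` (skeleton INTERFACE §3). The banked node `Skeleton.Lemma61` omits it (referee lanes
a/c, DEFECT of record 2026-08-25): `Lemma61A` below is the print-faithful (A)-form in this file's
namespace with the bridge `lemma61A_of_lemma61 : Skeleton.Lemma61 → Lemma61A`; the skeleton owner's
forthcoming `Lemma61_v2` supersedes it (expected `Iff.rfl`-equivalent).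

Conventions (skeleton INTERFACE §3): "`X ≪ Y`" ↦ `∃ C, ForAllLarge (… X ≤ C·Y)`; "`X = Y + O(E)`" ↦
`∃ C, ForAllLarge (… ‖X − Y‖ ≤ C·E)`; `ε = exp{−c𝓛¹⁰}` (§4 p. 19, tex L1062), `c > 0` unspecified ↦
`∃ c > 0, … Real.exp (−c𝓛¹⁰)`; the printed `E₁(s,ψ)` = `E1main x s + ε`. `(1/2πi)∫_{(c)} F(w)dw` =
`(1/2π)∫_ℝ F(c+iv)dv` (`vline`), `(1/2πi)∫_{c−iV}^{c+iV} F(w)dw` = `(1/2π)∫_{−V}^{V} F(c+iv)dv`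
(`vseg`); `ω₁(w) = exp{w²/(4𝓛³⁰)}` = the tree's `GaussWeight.omega1 (𝓛³⁰)` (§4 p. 18). The standing
hypotheses of Lemma 6.1 (`ψ ∈ Ψ`, `|σ − 1/2| < 2α`, `|t − 2πt₀| < 𝓛₁ + 2`) are
`∀ x : Chr D, ∀ s, InRange61 D s → …`; tails `Σ_{n ≥ T³}` are `tsum`s (absolutely convergent where
used, `Re(1−s−w) > 1`).

Textual notes recorded, not adjudicated (AMBIGUITY, typer's remit is statement-exact): (6.5) prints
the full line `∫_{(−1)}` and the range `n < T²` where (6.3)–(6.4) and the closing sentence ("moving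
the segment `u = −1, |v| ≤ 𝓛²⁰` …"; `E₁` has `n < T³`) have the segment and `n < T³` — `Idprime` is
typed AS PRINTED and `Step6split` states the printed sentence about it; `Step6u013` is justified in
the source by a dangling "(4.)" (sz-lit `LOCATORS.md`).

Deliberately NOT here: any discharge of an analytic claim; §7.

## References

* Y. Zhang, arXiv:2211.02515v1 (2022), §6 pp. 30–32, (6.1)–(6.5); §4 p. 18 (`ω₁`, `∫_{(c)}`),
  p. 19 (`ε`); §5 p. 28 (blanket (A)), Lemma 5.1; §2 (2.2). [cite: Zhang2022LandauSiegel, §6 (6.1)–(6.5)]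
-/

noncomputable section

open Complex Real ComplexConjugate MeasureTheory

namespace Literature.NumberTheory.LFunctions.Zhang2022.Section6Statements

open Skeleton

/-! ## Generic vertical-line / vertical-segment integrals -/

/-- `Z22:§6.u007` OBJECT (notation). `(1/2πi)∫_{(c)} F(w)dw`, the integral over the upward vertical
line `Re w = c` (`w = c + iv`, `dw = i dv`): `(1/2π)∫_ℝ F(c+iv)dv`.
[cite: Zhang2022LandauSiegel, §4 p.18, tex L979] -/
def vline (F : ℂ → ℂ) (c : ℝ) : ℂ := (1 / (2 * π) : ℂ) * ∫ v : ℝ, F ((c : ℂ) + (v : ℂ) * I)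

/-- `Z22:(6.3)` OBJECT (notation). `(1/2πi)∫_{c−iV}^{c+iV} F(w)dw`, the integral over the upward
vertical segment `Re w = c`, `|Im w| ≤ V`: `(1/2π)∫_{−V}^{V} F(c+iv)dv`.
[cite: Zhang2022LandauSiegel, §6 (6.3) p.32, tex L1755] -/
def vseg (F : ℂ → ℂ) (c V : ℝ) : ℂ :=
  (1 / (2 * π) : ℂ) * ∫ v in (-V)..V, F ((c : ℂ) + (v : ℂ) * I)

/-! ## The standing range of Lemma 6.1 and the §6 integrands -/

/-- `Z22:Lem6.1` OBJECT (hypotheses). The standing hypotheses of Lemma 6.1 on `s = σ + it`: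
`|σ − 1/2| < 2α` and `|t − 2πt₀| < 𝓛₁ + 2` (`ψ (mod p) ∈ Ψ` is `x : Chr D`).
[cite: Zhang2022LandauSiegel, §6 Lemma 6.1 p.30, tex L1692] -/
def InRange61 (D : ℕ) (s : ℂ) : Prop :=
  |s.re - 1 / 2| < 2 * alpha D ∧ |s.im - 2 * π * t0 D| < ell1 D + 2

/-- `Z22:§6.u007` OBJECT. The Perron kernel of §6: `P₄^w ω₁(w)/w` with `ω₁(w) = exp{w²/(4𝓛³⁰)}`
(§4 p. 18; the tree's `GaussWeight.omega1`). [cite: Zhang2022LandauSiegel, §6 (6.1) p.31, tex L1707] -/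
def kern (D : ℕ) (w : ℂ) : ℂ :=
  ((P4 D : ℝ) : ℂ) ^ w * GaussWeight.omega1 (ell D ^ 30) w / w

variable {D : ℕ} (x : Chr D)

/-- `Z22:§6.u007` OBJECT. The integrand `L(s+w,ψ)P₄^w ω₁(w)/w` of the Perron integrals `∫_{(±1)}`
of the proof of Lemma 6.1. [cite: Zhang2022LandauSiegel, §6 (6.1) p.31, tex L1707] -/
def integrandL (s w : ℂ) : ℂ := x.ψ.LFunction (s + w) * kern D w

/-- `Z22:§6.u009` OBJECT. The partial sum `Σ_{n<X} ψ̄(n)n^{−(1−s−w)}` (`X = T³` in the functional-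
equation split and (6.3)–(6.4); `X = T²` as printed in (6.5)).
[cite: Zhang2022LandauSiegel, §6 p.31, tex L1724] -/
def headSum (X : ℝ) (s w : ℂ) : ℂ :=
  ∑ n ∈ Finset.Ico 1 ⌈X⌉₊, psiBarFn x n * (n : ℂ) ^ (-(1 - s - w))

/-- `Z22:§6.u009` OBJECT. The tail `Σ_{n≥T³} ψ̄(n)n^{−(1−s−w)}` (a `tsum`; absolutely convergent for
`Re(1−s−w) > 1`, which holds on `Re w ≤ −1` for `s` in the range).
[cite: Zhang2022LandauSiegel, §6 p.31, tex L1724] -/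
def tailSum (s w : ℂ) : ℂ :=
  ∑' n : ℕ, if bigT D ^ 3 ≤ (n : ℝ) then psiBarFn x n * (n : ℂ) ^ (-(1 - s - w)) else 0

/-- `Z22:(6.2)` OBJECT. The integrand of (6.2): `Z(s+w,ψ)(Σ_{n≥T³} ψ̄(n)n^{−(1−s−w)})P₄^w ω₁(w)/w`.
[cite: Zhang2022LandauSiegel, §6 (6.2) p.31, tex L1729] -/
def integrand62 (s w : ℂ) : ℂ := GammaFactor.Zfac x.ψ (s + w) * tailSum x s w * kern D w

/-- `Z22:(6.3)` OBJECT. The integrand of (6.3): `Z(s+w,ψ)(Σ_{n<T³} ψ̄(n)n^{−(1−s−w)})P₄^w ω₁(w)/w`.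
[cite: Zhang2022LandauSiegel, §6 (6.3) p.32, tex L1755] -/
def integrand63 (s w : ℂ) : ℂ :=
  GammaFactor.Zfac x.ψ (s + w) * headSum x (bigT D ^ 3) s w * kern D w

/-- `Z22:(6.4)` OBJECT. The integrand of (6.4): `(Σ_{n<T³} ψ̄(n)n^{−(1−s−w)})T^{−2w}ω₁(w)/w`.
[cite: Zhang2022LandauSiegel, §6 (6.4) p.32, tex L1765] -/
def integrand64 (s w : ℂ) : ℂ :=
  headSum x (bigT D ^ 3) s w * ((bigT D : ℝ) : ℂ) ^ (-(2 * w)) *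
    GaussWeight.omega1 (ell D ^ 30) w / w

/-- `Z22:(6.5)` OBJECT, AS PRINTED. The integrand of (6.5): `(Z(s+w,ψ) − Z(s,ψ)(Pt₀)^{−w})
(Σ_{n<T²} ψ̄(n)n^{−(1−s−w)})P₄^w ω₁(w)/w` (printed range `n < T²`; AMBIGUITY vs the `n < T³` of
(6.3)–(6.4), see the module docstring). [cite: Zhang2022LandauSiegel, §6 (6.5) p.32, tex L1769] -/
def integrand65 (s w : ℂ) : ℂ :=
  (GammaFactor.Zfac x.ψ (s + w) - GammaFactor.Zfac x.ψ s * ((bigP D * t0 D : ℝ) : ℂ) ^ (-w)) *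
    headSum x (bigT D ^ 2) s w * kern D w

/-- `Z22:(6.4)` OBJECT. **`I′`** (6.4): `I′ = Z(s,ψ)·(1/2πi)∫_{−1−i𝓛²⁰}^{−1+i𝓛²⁰}
(Σ_{n<T³} ψ̄(n)n^{−(1−s−w)})T^{−2w}ω₁(w)dw/w`. [cite: Zhang2022LandauSiegel, §6 (6.4) p.32, tex L1765] -/
def Iprime (s : ℂ) : ℂ := GammaFactor.Zfac x.ψ s * vseg (integrand64 x s) (-1) (ell D ^ 20)

/-- `Z22:(6.5)` OBJECT, AS PRINTED. **`I″`** (6.5): `I″ = (1/2πi)∫_{(−1)} (Z(s+w,ψ) − Z(s,ψ)(Pt₀)^{−w})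
(Σ_{n<T²} ψ̄(n)n^{−(1−s−w)})P₄^w ω₁(w)dw/w` (full line `(−1)` and range `n < T²`, verbatim;
AMBIGUITY recorded in the module docstring). [cite: Zhang2022LandauSiegel, §6 (6.5) p.32, tex L1769] -/
def Idprime (s : ℂ) : ℂ := vline (integrand65 x s) (-1)

/-- `Z22:(6.3)` OBJECT. The left side of (6.3):
`(1/2πi)∫_{−1−i𝓛²⁰}^{−1+i𝓛²⁰} Z(s+w,ψ)(Σ_{n<T³} ψ̄(n)n^{−(1−s−w)})P₄^w ω₁(w)dw/w`.
[cite: Zhang2022LandauSiegel, §6 (6.3) p.32, tex L1755] -/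
def lhs63 (s : ℂ) : ℂ := vseg (integrand63 x s) (-1) (ell D ^ 20)

/-! ## Lemma 6.1 in its print-faithful (A)-form -/

/-- `Z22:Lem6.1` CLAIM, print-faithful form. **Lemma 6.1** (§6 p. 30) under the blanket Assumption (A)
of §5 p. 28 (tex L1559): for `ψ ∈ Ψ`, `|σ − 1/2| < 2α`, `|t − 2πt₀| < 𝓛₁ + 2`,
"`L(s,ψ) = K(s,ψ) + Z(s,ψ)N(1−s,ψ̄) + O(E₁(s,ψ))`". The banked node `Skeleton.Lemma61` is the same
statement WITHOUT the (A) antecedent (stronger than print); bridge `lemma61A_of_lemma61`. The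
skeleton owner's `Lemma61_v2` supersedes this decl when landed. STATED, NOT ASSERTED.
[cite: Zhang2022LandauSiegel, §6 Lemma 6.1 p.30, tex L1692] -/
def Lemma61A : Prop :=
  ∃ c : ℝ, 0 < c ∧ ∃ C : ℝ, ForAllLarge fun D _ χ => AssumptionA D χ → ∀ x : Chr D, ∀ s : ℂ,
    |s.re - 1 / 2| < 2 * alpha D → |s.im - 2 * π * t0 D| < ell1 D + 2 →
      ‖x.ψ.LFunction s - Kchar D (psiFn x) s -
          GammaFactor.Zfac x.ψ s * Nchar D (psiBarFn x) (1 - s)‖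
        ≤ C * (E1main x s + Real.exp (-c * ell D ^ 10))

/-- `Z22:Lem6.1` BRIDGE. The banked (A)-free node implies the print-faithful (A)-form (drop the
hypothesis). Kernel-checked. [cite: Zhang2022LandauSiegel, §6 Lemma 6.1 p.30, tex L1692] -/
theorem lemma61A_of_lemma61 (h : Lemma61) : Lemma61A := by
  obtain ⟨c, hc, C, D₀, h⟩ := h
  exact ⟨c, hc, C, D₀, fun D _ χ hD hq hp _ => h D χ hD hq hp⟩

/-! ## The proof of Lemma 6.1, claim by claim (pp. 31–32) -/

/-- `Z22:§6.u007` CLAIM. §6 p. 31: "By (4.3) we have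
`(1/2πi)∫_{(1)} L(s+w,ψ)P₄^w ω₁(w)dw/w = K(s,ψ) + O(ε)`" (`ε = exp{−c𝓛¹⁰}`, §4 p. 19), for `ψ ∈ Ψ`
and `s` in the range of Lemma 6.1; under the blanket (A). ((4.3) is the tree's
`GaussWeight.gWeight_le`.) [cite: Zhang2022LandauSiegel, §6 p.31, tex L1707] -/
def Step6u007 : Prop :=
  ∃ c : ℝ, 0 < c ∧ ∃ C : ℝ, ForAllLarge fun D _ χ => AssumptionA D χ → ∀ x : Chr D, ∀ s : ℂ,
    InRange61 D s →
      ‖vline (integrandL x s) 1 - Kchar D (psiFn x) s‖ ≤ C * Real.exp (-c * ell D ^ 10)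

/-- `Z22:§6.u008` CLAIM. §6 p. 31: "The left side above is, by moving the line of integration to
`u = −1`, equal to `L(s,ψ) + (1/2πi)∫_{(−1)} L(s+w,ψ)P₄^w ω₁(w)dw/w`" (the residue of
`L(s+w,ψ)P₄^w ω₁(w)/w` at `w = 0` is `L(s,ψ)`), for `ψ ∈ Ψ`, `s` in the range; under (A).
[cite: Zhang2022LandauSiegel, §6 p.31, tex L1711] -/
def Step6u008 : Prop :=
  ForAllLarge fun D _ χ => AssumptionA D χ → ∀ x : Chr D, ∀ s : ℂ, InRange61 D s →
    vline (integrandL x s) 1 = x.ψ.LFunction s + vline (integrandL x s) (-1)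

/-- `Z22:(6.1)` CLAIM. §6 p. 31, (6.1): "`(1/2πi)∫_{(−1)} L(s+w,ψ)P₄^w ω₁(w)dw/w = −Z(s,ψ)N(1−s,ψ̄)
+ O(E₁(s,ψ))`" (`E₁ = E1main + ε`), for `ψ ∈ Ψ`, `s` in the range; under (A).
[cite: Zhang2022LandauSiegel, §6 (6.1) p.31, tex L1715] -/
def Eq61 : Prop :=
  ∃ c : ℝ, 0 < c ∧ ∃ C : ℝ, ForAllLarge fun D _ χ => AssumptionA D χ → ∀ x : Chr D, ∀ s : ℂ,
    InRange61 D s →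
      ‖vline (integrandL x s) (-1) + GammaFactor.Zfac x.ψ s * Nchar D (psiBarFn x) (1 - s)‖
        ≤ C * (E1main x s + Real.exp (-c * ell D ^ 10))

/-- `Z22:§6.u009` CLAIM. §6 p. 31: "For `u = −1` we have, by the functional equation (2.2) with
`θ = ψ`, `L(s+w,ψ) = Z(s+w,ψ)(Σ_{n<T³} ψ̄(n)n^{−(1−s−w)} + Σ_{n≥T³} ψ̄(n)n^{−(1−s−w)})`"
(`w = −1 + iv`), for `ψ ∈ Ψ`, `s` in the range; under (A). ((2.2) is the tree's
`GammaFactor.LFunction_eq_Zfac_mul`.) [cite: Zhang2022LandauSiegel, §6 p.31, tex L1724] -/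
def Step6u009 : Prop :=
  ForAllLarge fun D _ χ => AssumptionA D χ → ∀ x : Chr D, ∀ s : ℂ, InRange61 D s → ∀ v : ℝ,
    x.ψ.LFunction (s + (-1 + v * I)) =
      GammaFactor.Zfac x.ψ (s + (-1 + v * I)) *
        (headSum x (bigT D ^ 3) s (-1 + v * I) + tailSum x s (-1 + v * I))

/-- `Z22:(6.2)` CLAIM. §6 p. 31, (6.2): "`∫_{(−1)} Z(s+w,ψ)(Σ_{n≥T³} ψ̄(n)n^{−(1−s−w)})P₄^w ω₁(w)dw/w
≪ ε`" (`∫_{(−1)} F(w)dw = i∫_ℝ F(−1+iv)dv`, same norm), for `ψ ∈ Ψ`, `s` in the range; under (A).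
[cite: Zhang2022LandauSiegel, §6 (6.2) p.31, tex L1729] -/
def Eq62 : Prop :=
  ∃ c : ℝ, 0 < c ∧ ∃ C : ℝ, ForAllLarge fun D _ χ => AssumptionA D χ → ∀ x : Chr D, ∀ s : ℂ,
    InRange61 D s →
      ‖∫ v : ℝ, integrand62 x s (-1 + v * I)‖ ≤ C * Real.exp (-c * ell D ^ 10)

/-- `Z22:§6.u010` `Z22:§6.u011` `Z22:§6.u012` CLAIM. §6 pp. 31–32: "We move the contour of
integration in (6.2) to the vertical segments `u = −1, |v| > 𝓛²⁰` and `u = −𝓛⁹, |v| ≤ 𝓛²⁰` with the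
horizontal connecting segments `−𝓛⁹ ≤ u ≤ −1, |v| = 𝓛²⁰`": the integral of the (6.2)-integrand over
`[−1−i𝓛²⁰, −1+i𝓛²⁰]` equals the integral over the three-sided path through `u = −𝓛⁹`
(`∫_{−1−iV}^{−L−iV} + ∫_{−L−iV}^{−L+iV} + ∫_{−L+iV}^{−1+iV}`, `V = 𝓛²⁰`, `L = 𝓛⁹`; `dw = du` on the
horizontals, `dw = i dv` on the verticals), for `ψ ∈ Ψ`, `s` in the range; under (A).
[cite: Zhang2022LandauSiegel, §6 pp.31–32, tex L1735–1745] -/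
def Step6u010 : Prop :=
  ForAllLarge fun D _ χ => AssumptionA D χ → ∀ x : Chr D, ∀ s : ℂ, InRange61 D s →
    I * (∫ v in (-(ell D ^ 20))..(ell D ^ 20), integrand62 x s (-1 + v * I)) =
      (∫ u in (-1 : ℝ)..(-(ell D ^ 9)), integrand62 x s (u + (-(ell D ^ 20) : ℝ) * I)) +
        I * (∫ v in (-(ell D ^ 20))..(ell D ^ 20), integrand62 x s ((-(ell D ^ 9) : ℝ) + v * I)) +
        ∫ u in (-(ell D ^ 9))..(-1 : ℝ), integrand62 x s (u + (ell D ^ 20 : ℝ) * I)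

/-- `Z22:Lem6.1.pf` (prose, p. 32) CLAIM: "By a trivial bound for `ω₁(w)` and simple estimates, the
integrals on the segments `u = −1`, `|v| > 𝓛²⁰` contribute `≪ ε`" (both half-lines), for `ψ ∈ Ψ`,
`s` in the range; under (A). [cite: Zhang2022LandauSiegel, §6 p.32, tex L1746] -/
def Step6outer : Prop :=
  ∃ c : ℝ, 0 < c ∧ ∃ C : ℝ, ForAllLarge fun D _ χ => AssumptionA D χ → ∀ x : Chr D, ∀ s : ℂ,
    InRange61 D s →
      ‖∫ v in Set.Ioi (ell D ^ 20), integrand62 x s (-1 + v * I)‖ ≤ C * Real.exp (-c * ell D ^ 10) ∧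
      ‖∫ v in Set.Iio (-(ell D ^ 20)), integrand62 x s (-1 + v * I)‖ ≤ C * Real.exp (-c * ell D ^ 10)

/-- `Z22:§6.u013` CLAIM. §6 p. 32: "in the case `−𝓛⁹ ≤ u ≤ −1`, `|v| ≤ 𝓛²⁰`, by (4.) we have
`Z(s+w,ψ)P₄^w ≪ (2T²)^{−u}`" (`w = u + iv`; AMBIGUITY: the reference "(4.)" is dangling in the
source), for `ψ ∈ Ψ`, `s` in the range; under (A). [cite: Zhang2022LandauSiegel, §6 p.32, tex L1747] -/
def Step6u013 : Prop :=
  ∃ C : ℝ, ForAllLarge fun D _ χ => AssumptionA D χ → ∀ x : Chr D, ∀ s : ℂ, InRange61 D s →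
    ∀ u v : ℝ, -(ell D ^ 9) ≤ u → u ≤ -1 → |v| ≤ ell D ^ 20 →
      ‖GammaFactor.Zfac x.ψ (s + (u + v * I)) * ((P4 D : ℝ) : ℂ) ^ ((u : ℂ) + v * I)‖
        ≤ C * (2 * bigT D ^ 2) ^ (-u)

/-- `Z22:§6.u014` CLAIM. §6 p. 32: "and `Σ_{n≥T³} ψ̄(n)n^{−(1−s−w)} ≪ T^{3u+1/2}`" (same case
`−𝓛⁹ ≤ u ≤ −1`, `|v| ≤ 𝓛²⁰`, `w = u + iv`), for `ψ ∈ Ψ`, `s` in the range; under (A).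
[cite: Zhang2022LandauSiegel, §6 p.32, tex L1751] -/
def Step6u014 : Prop :=
  ∃ C : ℝ, ForAllLarge fun D _ χ => AssumptionA D χ → ∀ x : Chr D, ∀ s : ℂ, InRange61 D s →
    ∀ u v : ℝ, -(ell D ^ 9) ≤ u → u ≤ -1 → |v| ≤ ell D ^ 20 →
      ‖tailSum x s (u + v * I)‖ ≤ C * bigT D ^ (3 * u + 1 / 2)

/-- `Z22:Lem6.1.pf` (prose, p. 32) CLAIM (proof node): "whence (6.2) follows" — the manuscript's
deduction of (6.2) from the contour move, the outer-segment bound and the two bounds on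
`−𝓛⁹ ≤ u ≤ −1` (discharged by proving the implication).
[cite: Zhang2022LandauSiegel, §6 (6.2) p.32, tex L1754] -/
def DedEq62 : Prop := Step6u010 → Step6outer → Step6u013 → Step6u014 → Eq62

/-- `Z22:(6.3)` CLAIM. §6 p. 32, (6.3): "`(1/2πi)∫_{−1−i𝓛²⁰}^{−1+i𝓛²⁰} Z(s+w,ψ)(Σ_{n<T³} ψ̄(n)n^{−(1−s−w)})
P₄^w ω₁(w)dw/w = −Z(s,ψ)N(1−s,ψ̄) + O(E₁(s,ψ))`" (`E₁ = E1main + ε`), for `ψ ∈ Ψ`, `s` in the range;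
under (A). [cite: Zhang2022LandauSiegel, §6 (6.3) p.32, tex L1755] -/
def Eq63 : Prop :=
  ∃ c : ℝ, 0 < c ∧ ∃ C : ℝ, ForAllLarge fun D _ χ => AssumptionA D χ → ∀ x : Chr D, ∀ s : ℂ,
    InRange61 D s →
      ‖lhs63 x s + GammaFactor.Zfac x.ψ s * Nchar D (psiBarFn x) (1 - s)‖
        ≤ C * (E1main x s + Real.exp (-c * ell D ^ 10))

/-- `Z22:Lem6.1.pf` (prose, p. 32) CLAIM (proof node): "The proof of (6.1) is therefore reduced to
showing (6.3)" — the manuscript's deduction of (6.1) from the functional-equation split, (6.2) and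
(6.3) (the `n < T³` part of the integral on `u = −1, |v| > 𝓛²⁰` being dropped silently).
[cite: Zhang2022LandauSiegel, §6 (6.1) p.32, tex L1754] -/
def DedEq61 : Prop := Step6u009 → Eq62 → Eq63 → Eq61

/-- `Z22:Lem6.1.pf` (prose, p. 32) PROVED: "Note that `Pt₀/P₄ = T²`" — from `P₄ = PT⁻²t₀`, for
`D ≥ 2` (so that `t₀ = 𝓛⁵¹⁹ ≠ 0`). [cite: Zhang2022LandauSiegel, §6 p.32, tex L1762] -/
theorem bigP_mul_t0_div_P4 {D : ℕ} (hD : 2 ≤ D) : bigP D * t0 D / P4 D = bigT D ^ 2 := by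
  have hP : 0 < bigP D := Real.exp_pos _
  have hT : 0 < bigT D := Real.exp_pos _
  have hℓ : 0 < ell D := Real.log_pos (by exact_mod_cast hD)
  have ht : 0 < t0 D := pow_pos hℓ 519
  unfold P4
  field_simp

/-- `Z22:Lem6.1.pf` (prose, p. 32) CLAIM: "The left side of (6.3) is equal to `I′ + I″`" with `I′`,
`I″` of (6.4), (6.5) AS PRINTED (AMBIGUITY on (6.5)'s `∫_{(−1)}` and `n < T²`, module docstring),
for `ψ ∈ Ψ`, `s` in the range; under (A). [cite: Zhang2022LandauSiegel, §6 (6.4)–(6.5) p.32, tex L1762] -/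
def Step6split : Prop :=
  ForAllLarge fun D _ χ => AssumptionA D χ → ∀ x : Chr D, ∀ s : ℂ, InRange61 D s →
    lhs63 x s = Iprime x s + Idprime x s

/-- `Z22:§6.u015` CLAIM. §6 p. 32: "Replacing the segment `u = −1, |v| ≤ 𝓛²⁰` by `u = −1` and using
the change of variable `w → −w`, we obtain `I′ = −Z(s,ψ)N(1−s,ψ̄) + O(ε)`", for `ψ ∈ Ψ`, `s` in the
range; under (A). [cite: Zhang2022LandauSiegel, §6 p.32, tex L1774] -/
def Step6u015 : Prop :=
  ∃ c : ℝ, 0 < c ∧ ∃ C : ℝ, ForAllLarge fun D _ χ => AssumptionA D χ → ∀ x : Chr D, ∀ s : ℂ,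
    InRange61 D s →
      ‖Iprime x s + GammaFactor.Zfac x.ψ s * Nchar D (psiBarFn x) (1 - s)‖
        ≤ C * Real.exp (-c * ell D ^ 10)

/-- `Z22:Lem6.1.pf` (prose, p. 32, last sentence) CLAIM: "moving the segment `u = −1, |v| ≤ 𝓛²⁰` to
`u = 0, |v| ≤ 𝓛²⁰` and applying Lemma 5.1, we find the right side of (6.5) is `≪ E₁(s,ψ)`"
(`E₁ = E1main + ε`; Lemma 5.1 is the node `Skeleton.Lemma51`), for `ψ ∈ Ψ`, `s` in the range;
under (A). [cite: Zhang2022LandauSiegel, §6 p.32, tex L1777] -/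
def Step6last : Prop :=
  ∃ c : ℝ, 0 < c ∧ ∃ C : ℝ, ForAllLarge fun D _ χ => AssumptionA D χ → ∀ x : Chr D, ∀ s : ℂ,
    InRange61 D s →
      ‖Idprime x s‖ ≤ C * (E1main x s + Real.exp (-c * ell D ^ 10))

/-! ## Kernel-checked edges: the purely additive deductions, and the whole §6 proof node -/

/-- Monotonicity of `ε = exp{−c𝓛¹⁰}` in `c`: for `c ≤ c′`, `exp{−c′𝓛¹⁰} ≤ exp{−c𝓛¹⁰}` (`𝓛 = log D ≥ 0`).
[folklore] -/
private theorem eps_mono {c c' : ℝ} (h : c ≤ c') (D : ℕ) :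
    Real.exp (-c' * ell D ^ 10) ≤ Real.exp (-c * ell D ^ 10) := by
  have hℓ : 0 ≤ ell D ^ 10 := pow_nonneg (Real.log_natCast_nonneg D) _
  exact Real.exp_le_exp.mpr (by nlinarith)

/-- The additive bookkeeping behind both edges: from `a ≤ C₁ε₁` and `b ≤ C₂(E + ε₂)` with `E ≥ 0`,
`a + b ≤ (C₁⁺ + C₂⁺)(E + exp{−min(c₁,c₂)𝓛¹⁰})`. [folklore] -/
private theorem merge_bound {D : ℕ} {a b E c₁ c₂ C₁ C₂ : ℝ} (hE : 0 ≤ E)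
    (ha : a ≤ C₁ * Real.exp (-c₁ * ell D ^ 10))
    (hb : b ≤ C₂ * (E + Real.exp (-c₂ * ell D ^ 10))) :
    a + b ≤ (max C₁ 0 + max C₂ 0) * (E + Real.exp (-(min c₁ c₂) * ell D ^ 10)) := by
  have hε₁ := eps_mono (min_le_left c₁ c₂) D
  have hε₂ := eps_mono (min_le_right c₁ c₂) D
  have i1 : C₁ * Real.exp (-c₁ * ell D ^ 10) ≤ max C₁ 0 * Real.exp (-c₁ * ell D ^ 10) :=
    mul_le_mul_of_nonneg_right (le_max_left _ _) (Real.exp_pos _).le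
  have i2 : C₂ * (E + Real.exp (-c₂ * ell D ^ 10)) ≤ max C₂ 0 * (E + Real.exp (-c₂ * ell D ^ 10)) :=
    mul_le_mul_of_nonneg_right (le_max_left _ _) (add_nonneg hE (Real.exp_pos _).le)
  have j1 : max C₁ 0 * Real.exp (-c₁ * ell D ^ 10) ≤
      max C₁ 0 * (E + Real.exp (-(min c₁ c₂) * ell D ^ 10)) :=
    mul_le_mul_of_nonneg_left (by linarith) (le_max_right _ _)
  have j2 : max C₂ 0 * (E + Real.exp (-c₂ * ell D ^ 10)) ≤
      max C₂ 0 * (E + Real.exp (-(min c₁ c₂) * ell D ^ 10)) :=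
    mul_le_mul_of_nonneg_left (by linarith) (le_max_right _ _)
  linarith

/-- `Z22:Lem6.1.pf` EDGE. §6 p. 31, "It therefore suffices to show (6.1)" — kernel-checked: the
(4.3)-step `Step6u007`, the contour shift `Step6u008` and (6.1) imply Lemma 6.1 in its print-faithful
(A)-form `Lemma61A` (`L − K − ZN = (∫_{(1)} − K) − (∫_{(−1)} + ZN)`, `ε`-constants merged by `min`).
[cite: Zhang2022LandauSiegel, §6 p.31, tex L1714] -/
theorem lemma61A_of_steps (hK : Step6u007) (hS : Step6u008) (h61 : Eq61) : Lemma61A := by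
  obtain ⟨c₁, hc₁, C₁, h₁⟩ := hK
  obtain ⟨c₃, hc₃, C₃, h₃⟩ := h61
  refine ⟨min c₁ c₃, lt_min hc₁ hc₃, max C₁ 0 + max C₃ 0, ?_⟩
  obtain ⟨D₀, h⟩ := (h₁.and hS).and h₃
  refine ⟨D₀, fun D _ χ hD hq hp hA x s hσ ht => ?_⟩
  obtain ⟨⟨hK', hS'⟩, h61'⟩ := h D χ hD hq hp
  have hr : InRange61 D s := ⟨hσ, ht⟩
  have e1 := hK' hA x s hr
  have e2 := hS' hA x s hr
  have e3 := h61' hA x s hr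
  have key : x.ψ.LFunction s - Kchar D (psiFn x) s -
      GammaFactor.Zfac x.ψ s * Nchar D (psiBarFn x) (1 - s) =
      (vline (integrandL x s) 1 - Kchar D (psiFn x) s) -
        (vline (integrandL x s) (-1) + GammaFactor.Zfac x.ψ s * Nchar D (psiBarFn x) (1 - s)) := by
    rw [e2]; ring
  rw [key]
  exact le_trans (norm_sub_le _ _) (merge_bound (E1main_nonneg x s) e1 e3)

/-- `Z22:Lem6.1.pf` EDGE. §6 p. 32, (6.3) from "`= I′ + I″`", "`I′ = −ZN + O(ε)`" and "`I″ ≪ E₁`" —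
kernel-checked: `Step6split`, `Step6u015`, `Step6last` imply `Eq63` (triangle inequality,
`ε`-constants merged by `min`). [cite: Zhang2022LandauSiegel, §6 (6.3) p.32, tex L1762–1778] -/
theorem eq63_of_steps (hS : Step6split) (hI : Step6u015) (hII : Step6last) : Eq63 := by
  obtain ⟨c₁, hc₁, C₁, h₁⟩ := hI
  obtain ⟨c₂, hc₂, C₂, h₂⟩ := hII
  refine ⟨min c₁ c₂, lt_min hc₁ hc₂, max C₁ 0 + max C₂ 0, ?_⟩
  obtain ⟨D₀, h⟩ := (hS.and h₁).and h₂
  refine ⟨D₀, fun D _ χ hD hq hp hA x s hr => ?_⟩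
  obtain ⟨⟨hS', hI'⟩, hII'⟩ := h D χ hD hq hp
  have e0 := hS' hA x s hr
  have e1 := hI' hA x s hr
  have e2 := hII' hA x s hr
  have key : lhs63 x s + GammaFactor.Zfac x.ψ s * Nchar D (psiBarFn x) (1 - s) =
      (Iprime x s + GammaFactor.Zfac x.ψ s * Nchar D (psiBarFn x) (1 - s)) + Idprime x s := by
    rw [e0]; ring
  rw [key]
  exact le_trans (norm_add_le _ _) (merge_bound (E1main_nonneg x s) e1 e2)

/-- `Z22:Lem6.1.pf` EDGE (the whole §6 proof node). The manuscript's proof of Lemma 6.1, kernel-checked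
as one implication: its ten leaf claims (`Step6u007`, `Step6u008`, `Step6u009`, `Step6u010`,
`Step6outer`, `Step6u013`, `Step6u014`, `Step6split`, `Step6u015`, `Step6last`) together with its
two prose deductions that are themselves claims (`DedEq62` "whence (6.2) follows", `DedEq61` "reduced to
showing (6.3)") yield Lemma 6.1 in its print-faithful (A)-form. Refines the leaf `h61 : Skeleton.Lemma61`
of `Skeleton.theorem1_of_leaves` (modulo the (A)-bridge owned by the skeleton).
[cite: Zhang2022LandauSiegel, §6 pp.31–32, tex L1706–1778] -/
theorem dedLem61 (hD62 : DedEq62) (hD61 : DedEq61)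
    (h7 : Step6u007) (h8 : Step6u008) (h9 : Step6u009) (h10 : Step6u010) (hout : Step6outer)
    (h13 : Step6u013) (h14 : Step6u014) (hsplit : Step6split) (h15 : Step6u015)
    (hlast : Step6last) : Lemma61A :=
  lemma61A_of_steps h7 h8 (hD61 h9 (hD62 h10 hout h13 h14) (eq63_of_steps hsplit h15 hlast))

end Literature.NumberTheory.LFunctions.Zhang2022.Section6Statements
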